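import Literature.MathematicalPhysics.QuantumFieldTheory.Balaban1983to89.B9Eq319ContourAxialGauge
import Literature.MathematicalPhysics.QuantumFieldTheory.Balaban1983to89.B9Ineq369CurvatureOperatorBound

/-!
# `Balaban1983to89.B9Eq34CurlGaugeModeWindow` — T. Bałaban, *Propagators for lattice gauge theories in a background field*, Commun. Math. Phys. **99**
# (1985) 389–434 [Balaban1985BackgroundPropagators] (3.3)–(3.4) p. 391, (3.10) p. 392, (3.35)–(3.36) p. 396 and (3.117)∕(3.120) p. 419:
# **THE CURL OF A PURE GAUGE MODE IS THE PLAQUETTE-HOLONOMY COMMUTATOR, HENCE `O(α)` IN `L²` UNIFORMLY IN THE LATTICE SPACING, AND THE HESSIAN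
# (3.10) AGAINST A PURE GAUGE MODE IS SMALL** — `‖D_U(D_Uλ)‖_{L²} ≤ 2M_φ′M_φ√#{μ<ν}·α·‖λ‖_{L²}` under print's window `‖U(∂p) − 1‖ ≤ αη²`, and
# `‖⟨u, Δ^η(U)(D_Uλ)⟩‖ ≤ ‖D_Uu‖·‖D_U(D_Uλ)‖ + 32dC_τM_φ²(|η|^d∕c₀)(η⁻²ε)·‖D_Uλ‖·‖u‖` — the `L²` content of the small-current reading (paraphrase, not a quotation) for the NE9
# owner's `Δ_π` port (step (ii): the form-smallness of `Δ′_π = π†Δπ − Δ`, whose three terms pair `Δ^η(U)` with the gauge modes `D_U(G′R_kD*_U·)`)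

statement-level skeleton of published theorems with citation tags; proofs where landed; nothing here is a claim about the Yang–Mills mass gap

PDF held: `paper:balaban1985-cmp99-background-propagators` (journal page = PDF page + 388), pp. 390–392, 396, 418–419 — read by this seat through the
verbatim quotations of `B9Eq34CovCurlVector` (the holonomy-defect identity behind (3.4)∘(3.3)), `B9Eq310HessianOperator` ∕ `B9Eq310DeltaPrime` ((3.10)),
`B9Ineq369CurvatureSmall` ∕ `…OperatorBound` ((3.69), p. 392 «Δ′ … a bounded, small operator»), `B9Eq3117Current` ((3.117)).

CITATION HEADER (lean-in-tree rule).  Audit cell `pub-balaban`, sub-cell `t4`, BINDER row NE9; filed by the NE9 crux-team (2) LEAF PROVER 02 lineage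
`b2b-balaban-t4-ne9-formalise-leaf-02` (gen 67) as a SUPPLIER LETTER for the row OWNER t4-ne9-p1 g87's `DELTA-PI-PROGRAMME.md` step (ii)
(`B9Eq3120DeltaPiPrimeFormTower`, OPEN): the θ-letter `|⟨u, (π_k†Δ^ηπ_k − Δ^η)v⟩| ≤ θ(α)N₁(u)N₁(v)` of his `B9Eq3130HessianSlotPerturbationDiagonal`.

THE PRINT (p. 392 verbatim via the supplier `B9Ineq369CurvatureSmall`; pp. 396 ∕ 419 PARAPHRASED, no quotation).  p. 391 (3.3)–(3.4): the covariant
derivative and curl; p. 392: *«with our assumptions on the configuration U the operator Δ′ will be a bounded, small operator»*; p. 396 (3.35)–(3.36):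
the small-field conditions on the background (a bound on `∂^{η*}∂^η` of the background field on blocks — the smallness this file converts into `O(α)`;
paraphrase); p. 419 (3.117): the current identity for `⟨Dλ, J⟩` and the second-order term in `λ` (paraphrase) — the Hessian against a gauge mode is a
current term.

WHY THIS FILE (cell context).  DIAGNOSIS D-ne9p1-g87-1: the chain's `k`-th-step letters sit in print's `G₀`-slot; the port to `G̃⁻¹ = Δ_π + DRD* + Q*aQ`
((3.122); `B9Eq3119DeltaPiTower`) needs ONE estimate — the form defect of `Δ′_π = π†Δ^ηπ − Δ^η`, `π = 1 − D_UG′R_kD*_U`.  Expanding,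
`⟨u, Δ′_πv⟩ = −⟨D_Uλ_u, Δ^ηv⟩ − ⟨u, Δ^ηD_Uλ_v⟩ + ⟨D_Uλ_u, Δ^ηD_Uλ_v⟩` with `λ_w := G′R_kD*_Uw`: every term pairs the Hessian with a PURE GAUGE MODE.
Print controls these through the current `J` ((3.117), (3.120), (3.36)); the tree has (3.117) only on lit-balaban's `B9Eq39Adjoint` carrier.  THIS FILE gives
the same control DIRECTLY at the chain's `hessOp = D*D + Δ′` (`B9Eq310HessianOperator`): the principal part pairs `D_Uu` with `D_U(D_Uλ)`, which is the
plaquette-holonomy commutator (`B9Eq34CovCurlVector.covCurl_covDeriv` — no first-order term survives) and therefore `O(‖U(∂p) − 1‖·η⁻²) = O(α)`; the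
curvature part `Δ′` is a small bilinear form (the OWNER's `B9Ineq369CurvatureOperatorBound.norm_inner_curvOp_le`).  No carrier bridge, no `J`, no (3.117).

WHAT IS PROVED (sorry-free; proof lane — no `def`, no `Prop` placeholder; [folklore] lattice calculus + Cauchy–Schwarz over landed identities).
* §1 **`covCurl_covDeriv_adTransportW`** (`(D_U(D_Uλ))(p_{μν}(x)) = c²·(R(W₁) − R(W₂))λ(x+e_μ+e_ν)` on the fibre, `W₁ = U(x,μ)U(x+e_μ,ν)`,
  `W₂ = U(x,ν)U(x+e_ν,μ)`), **`norm_AdW_sub_AdW_le`** (`‖R(W₁)w − R(W₂)w‖ ≤ 2ε·M_φ′M_φ‖w‖` for `W₁, W₂ ∈ U1`, `‖W₁W₂⁻¹ − 1‖ ≤ ε`),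
  **`norm_covCurl_covDeriv_le`** (`‖(D_U(D_Uλ))(p)‖ ≤ ‖c‖²·2ε·M_φ′M_φ·‖λ(z_p)‖` under `U(b) ∈ U1`, `‖U(∂p) − 1‖ ≤ ε`; `W₁W₂⁻¹ = plaqHolU U p` by `rfl`-algebra).
* §2 **`norm_sq_covCurlL2K_covDerivL2K_le`** ∕ **`norm_covCurlL2K_covDerivL2K_le`**: `‖D_U(D_Uλ)‖_{L²} ≤ ‖c‖²·2ε·M_φ′M_φ·√#DirPair·‖λ‖_{L²}` on the weighted
  carriers `SiteL2K → BondL2K → PlaqL2K` (same weight `c₀`; each site is the far corner of exactly one plaquette per direction pair — the translations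
  `B9Eq33CovDerivVector.shiftEquiv` are bijections).
* §3 **`norm_covCurlL2K_covDerivL2K_le_window`**: at `c = η⁻¹` and print's window `‖U(∂p) − 1‖ ≤ αη²`:
  `‖D_U(D_Uλ)‖_{L²} ≤ 2M_φ′M_φ√#DirPair·α·‖λ‖_{L²}` — `η`-FREE (the two powers of `η⁻¹` are paid by the window).
* §4 **`norm_inner_principalOpK_le`** (`|⟨u, D*Dw⟩| ≤ ‖D_Uu‖‖D_Uw‖`, transporters mutually adjoint — `hRS`) and
  **`norm_inner_hessOp_covDerivL2K_le`**: `‖⟨u, Δ^η(U)(D_Uλ)⟩‖ ≤ ‖D_Uu‖·‖D_U(D_Uλ)‖ + 32dC_τM_φ²(|η|^d∕c₀)(η⁻²ε)·‖D_Uλ‖·‖u‖` (the curvature part by the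
  OWNER's polarised bound `B9Ineq369CurvatureOperatorBound.norm_inner_curvOp_le` BY NAME).
* §5 **`norm_inner_hessOp_covDerivL2K_le_window`**: at `η⁻¹`, `‖U(∂p) − 1‖ ≤ αη²`, `|η|^d∕c₀ ≤ ρ_w`:
  `‖⟨u, Δ^η(U)(D_Uλ)⟩‖ ≤ α·(2M_φ′M_φ√#DirPair·‖D_Uu‖·‖λ‖ + 32dC_τM_φ²ρ_w·‖D_Uλ‖·‖u‖)` — the small-current reading, `η`-free.
HOW (ii) CONSUMES IT (not done here): with §3, `|η|^d∕c₀ ≤ ρ_w` and `η⁻²ε = α`, both terms are `≤ C·α·(‖D_Uu‖ + ‖u‖)(‖λ‖ + ‖D_Uλ‖)`; `‖D_Uu‖ ≤ N₁(u) + O(α)‖u‖`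
(flat vs `U`-transport), and for `λ = G′_kR_kD*_Uv`: `‖λ‖, ‖D_Uλ‖ ≤ C·N₁(v)` by the coercivity of `Δ′_{a′,k}` on the diagonal (g85) — `η`-free.
MODEL ∕ DECLARED READINGS.  (M1) any torus `TSite d Pd`, fibre `W` read along `φ` (`M_φ`, `M_φ′`), weight `c₀`, scalar `c` (§3: `η⁻¹`, `η ≠ 0`), trace `τ` with
`‖τX‖ ≤ C_τ‖X‖`; `U(b) ∈ U1` (unit-bounded with its inverse); the plaquette window DISPLAYED.  (M2) §4 displays `hRS` (the transporters of `U` and `U⁻¹`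
mutually adjoint on the fibre — the unitary class), nothing else.
HONEST SCOPE.  [folklore] one algebraic identity read on the fibre, norms, a bijective reindexing, Cauchy–Schwarz; the plaquette window is a HYPOTHESIS;
nothing of [B9] asserted ((3.36)∕(3.117) are what these lemmas REPLACE at the chain's letters, not what they prove); NOT the θ-letter itself (the `G′R_kD*`
letter bounds and the three-term assembly are the OWNER's step (ii)).  NOT summit progress (cell pub-balaban: NE9 NOT PRINTED ∕ NOT PROVED; «NE9 ⇐ the
named binders»; row WALLED ON A MODEL (O-NE9-1; NEEDS-COORDINATOR #5 UNRULED); spine PROVED 0∕9; rung (B)+1 finite T⁴ — NOT infinite volume, NOT mass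
gap, NOT BetaPertH, NOT Clay).  HONEST DEPENDENCY (cell line): continuum YM on T⁴ ⇐ BetaPertH ∧ nine spine estimates (0/9 proved); BetaPertH ⇐ (D1) ∧
(D4) ∧ CAP+tail; G-an2-4 gates asym, D1 and NE2/3/4.  NEW file; nothing modified.  Net new unproved facts: 0.
-/

noncomputable section

open scoped BigOperators InnerProductSpace ComplexConjugate

namespace Literature.MathematicalPhysics.QuantumFieldTheory.Balaban1983to89.B9Eq34CurlGaugeModeWindow

open B4Sect5Torus (TSite)
open B9SectCLatticeCarrier (Bond DirPair shift)
open B7Prop1Explicit (U1 mem_U1)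
open B7Eq78Linearization (conjR conjR_apply)
open B9Eq33CovDerivVector (covDeriv covDeriv_apply shiftEquiv)
open B9Eq34CovCurlVector (covCurl covCurl_covDeriv)
open B9Eq311L2Pairing (WL2)
open B11Eq103H1Complex (SiteL2K BondL2K covDerivL2K equiv_covDerivL2K)
open B9Eq310HessianOperator (adTransportW adTransportW_apply PlaqL2K covCurlL2K covCoCurlL2K equiv_covCurlL2K toAlg curvOp inner_curvOp principalOpK
  principalOpK_eq_comp covCoCurlL2K_comp_eq_adjoint_comp hessOp hessOp_apply)
open B9Eq328GaugeAction (AdW AdW_apply adTransportW_eq_AdW AdW_mul_apply)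
open B9Eq310DeltaPrime (plaqHolU)
open B9Eq319QprimeLipschitz (norm_conj_sub_le_of_mem_U1)
open B9Ineq369CurvatureSmall (norm_conj_le)
open B9Ineq369CurvatureOperatorBound (norm_inner_curvOp_le)
open Finset

variable {d : ℕ} {Pd : Fin d → ℕ}
  {𝔸 : Type*} [NormedRing 𝔸] [NormedAlgebra ℂ 𝔸] [NormOneClass 𝔸]
  {W : Type*} [NormedAddCommGroup W] [InnerProductSpace ℂ W] (φ : W ≃ₗ[ℂ] 𝔸)
  {Mφ Mφ' : ℝ}

/-! ## §1 The curl of a pure gauge mode on one plaquette: the holonomy commutator -/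

omit [NormOneClass 𝔸] in
/-- **`(D_U(D_Uλ))(p_{μν}(x)) = c²·(R(W₁) − R(W₂))λ(x + e_μ + e_ν)`** with the two path transporters `W₁ = U(x,μ)U(x+e_μ,ν)`, `W₂ = U(x,ν)U(x+e_ν,μ)`
from the far corner, read on the fibre `W` (`B9Eq34CovCurlVector.covCurl_covDeriv` at the transporters `R(U(b)) = AdW φ (U b)`).
[cite: Balaban1985BackgroundPropagators, (3.3)–(3.4) p.391] -/
theorem covCurl_covDeriv_adTransportW (c : ℂ) (U : Bond d Pd → 𝔸ˣ) (f : TSite d Pd → W) (x : TSite d Pd) (q : DirPair d) :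
    covCurl c (adTransportW φ U) (covDeriv c (adTransportW φ U) f) (x, q) =
      (c * c) • (AdW φ (U (x, q.1.1) * U (shift q.1.1 x, q.1.2)) (f (shift q.1.2 (shift q.1.1 x))) -
        AdW φ (U (x, q.1.2) * U (shift q.1.2 x, q.1.1)) (f (shift q.1.2 (shift q.1.1 x)))) := by
  rw [covCurl_covDeriv, adTransportW_eq_AdW, adTransportW_eq_AdW, adTransportW_eq_AdW, adTransportW_eq_AdW, ← AdW_mul_apply, ← AdW_mul_apply]

/-- **`‖R(W₁)w − R(W₂)w‖ ≤ 2ε·M_φ′M_φ·‖w‖` when `W₁, W₂ ∈ U1` and `‖W₁W₂⁻¹ − 1‖ ≤ ε`**: `R(W₁)w − R(W₂)w = φ⁻¹(h·Y·h⁻¹ − Y)` with `h = W₁W₂⁻¹`,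
`Y = W₂(φw)W₂⁻¹`. [cite: Balaban1985BackgroundPropagators, p.390, (3.35) p.396] -/
theorem norm_AdW_sub_AdW_le (hMφ' : 0 ≤ Mφ') (hφ : ∀ w, ‖φ w‖ ≤ Mφ * ‖w‖) (hφ' : ∀ X, ‖φ.symm X‖ ≤ Mφ' * ‖X‖) {W₁ W₂ : 𝔸ˣ} (h₁ : W₁ ∈ U1 𝔸) (h₂ : W₂ ∈ U1 𝔸) {ε : ℝ} (hε : ‖((W₁ * W₂⁻¹ : 𝔸ˣ) : 𝔸) - 1‖ ≤ ε) (w : W) :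
    ‖AdW φ W₁ w - AdW φ W₂ w‖ ≤ 2 * ε * (Mφ' * Mφ) * ‖w‖ := by
  have hY : ‖((W₂ : 𝔸) * φ w * ((W₂⁻¹ : 𝔸ˣ) : 𝔸))‖ ≤ ‖φ w‖ := norm_conj_le (mem_U1.1 h₂) (φ w)
  have hh : W₁ * W₂⁻¹ ∈ U1 𝔸 := (U1 𝔸).mul_mem h₁ ((U1 𝔸).inv_mem h₂)
  have e : AdW φ W₁ w - AdW φ W₂ w =
      φ.symm (((W₁ * W₂⁻¹ : 𝔸ˣ) : 𝔸) * ((W₂ : 𝔸) * φ w * ((W₂⁻¹ : 𝔸ˣ) : 𝔸)) * (((W₁ * W₂⁻¹)⁻¹ : 𝔸ˣ) : 𝔸) -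
        (W₂ : 𝔸) * φ w * ((W₂⁻¹ : 𝔸ˣ) : 𝔸)) := by
    rw [AdW_apply, AdW_apply, ← map_sub]
    congr 1
    simp only [mul_inv_rev, inv_inv, Units.val_mul, mul_assoc, Units.inv_mul_cancel_left]
  rw [e]
  calc ‖φ.symm _‖ ≤ Mφ' * ‖((W₁ * W₂⁻¹ : 𝔸ˣ) : 𝔸) * ((W₂ : 𝔸) * φ w * ((W₂⁻¹ : 𝔸ˣ) : 𝔸)) * (((W₁ * W₂⁻¹)⁻¹ : 𝔸ˣ) : 𝔸) -
        (W₂ : 𝔸) * φ w * ((W₂⁻¹ : 𝔸ˣ) : 𝔸)‖ := hφ' _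
    _ ≤ Mφ' * (2 * ε * ‖(W₂ : 𝔸) * φ w * ((W₂⁻¹ : 𝔸ˣ) : 𝔸)‖) :=
        mul_le_mul_of_nonneg_left (norm_conj_sub_le_of_mem_U1 hh hε _) hMφ'
    _ ≤ Mφ' * (2 * ε * (Mφ * ‖w‖)) := by
        have hε0 : 0 ≤ ε := (norm_nonneg _).trans hε
        gcongr
        exact hY.trans (hφ w)
    _ = 2 * ε * (Mφ' * Mφ) * ‖w‖ := by ring

/-- **THE CURL OF A PURE GAUGE MODE ON ONE PLAQUETTE IS `O(ε)`**: for unit-bounded `U` with the plaquette window `‖U(∂p) − 1‖ ≤ ε`,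
`‖(D_U(D_Uλ))(p)‖ ≤ ‖c‖²·2ε·M_φ′M_φ·‖λ(z_p)‖`, `z_p` the far corner — the holonomy `W₁W₂⁻¹ = U(∂p)` (`B9Eq310DeltaPrime.plaqHolU`) measures the defect.
[cite: Balaban1985BackgroundPropagators, (3.3)–(3.4) p.391, (3.35)–(3.36) p.396] -/
theorem norm_covCurl_covDeriv_le (hMφ' : 0 ≤ Mφ') (hφ : ∀ w, ‖φ w‖ ≤ Mφ * ‖w‖) (hφ' : ∀ X, ‖φ.symm X‖ ≤ Mφ' * ‖X‖) (c : ℂ) {U : Bond d Pd → 𝔸ˣ} (hU : ∀ b, U b ∈ U1 𝔸) {ε : ℝ}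
    (hpl : ∀ p : B9SectCLatticeCarrier.Plaq d Pd, ‖(plaqHolU U p : 𝔸) - 1‖ ≤ ε) (f : TSite d Pd → W) (x : TSite d Pd) (q : DirPair d) :
    ‖covCurl c (adTransportW φ U) (covDeriv c (adTransportW φ U) f) (x, q)‖ ≤
      ‖c‖ ^ 2 * (2 * ε * (Mφ' * Mφ)) * ‖f (shift q.1.2 (shift q.1.1 x))‖ := by
  rw [covCurl_covDeriv_adTransportW, norm_smul, norm_mul, ← sq, mul_assoc]
  refine mul_le_mul_of_nonneg_left ?_ (sq_nonneg _)
  have hW : (U (x, q.1.1) * U (shift q.1.1 x, q.1.2)) * (U (x, q.1.2) * U (shift q.1.2 x, q.1.1))⁻¹ = plaqHolU U (x, q) := by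
    simp only [plaqHolU, mul_inv_rev, mul_assoc]
  exact norm_AdW_sub_AdW_le φ hMφ' hφ hφ' ((U1 𝔸).mul_mem (hU _) (hU _)) ((U1 𝔸).mul_mem (hU _) (hU _)) (by rw [hW]; exact hpl _) _

/-! ## §2 In `L²`: every site is the far corner of `#DirPair d` plaquettes -/

variable {c₀ : ℝ} [Fact (0 < c₀)]

/-- **`‖D_U(D_Uλ)‖²_{L²} ≤ (‖c‖²·2ε·M_φ′M_φ)²·#{μ<ν}·‖λ‖²_{L²}`** on the weighted carriers (plaquettes and sites carry the same weight `c₀`): the pointwise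
bound of §1 summed, each site being the far corner `x + e_μ + e_ν` of exactly one plaquette per direction pair (the translations `shiftEquiv` are
bijections of the torus). [cite: Balaban1985BackgroundPropagators, (3.4) p.391, (3.11) p.392, (3.36) p.396] -/
theorem norm_sq_covCurlL2K_covDerivL2K_le (hMφ' : 0 ≤ Mφ') (hφ : ∀ w, ‖φ w‖ ≤ Mφ * ‖w‖) (hφ' : ∀ X, ‖φ.symm X‖ ≤ Mφ' * ‖X‖) (c : ℂ)
    {U : Bond d Pd → 𝔸ˣ} (hU : ∀ b, U b ∈ U1 𝔸) {ε : ℝ} (hpl : ∀ p : B9SectCLatticeCarrier.Plaq d Pd, ‖(plaqHolU U p : 𝔸) - 1‖ ≤ ε)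
    (l : SiteL2K ℂ d Pd c₀ W) :
    ‖covCurlL2K ℂ c₀ c (adTransportW φ U) (covDerivL2K ℂ c₀ c (adTransportW φ U) l)‖ ^ 2 ≤
      (‖c‖ ^ 2 * (2 * ε * (Mφ' * Mφ))) ^ 2 * Fintype.card (DirPair d) * ‖l‖ ^ 2 := by
  have hc₀ : 0 < c₀ := Fact.out
  set K : ℝ := ‖c‖ ^ 2 * (2 * ε * (Mφ' * Mφ)) with hK
  set lt := WL2.equiv ℂ (fun _ : TSite d Pd => c₀) W l with hlt
  rw [WL2.norm_sq (𝕜 := ℂ) (w := fun _ : B9SectCLatticeCarrier.Plaq d Pd => c₀) (V := W),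
    WL2.norm_sq (𝕜 := ℂ) (w := fun _ : TSite d Pd => c₀) (V := W) l]
  have hpt : ∀ p : B9SectCLatticeCarrier.Plaq d Pd,
      c₀ * ‖WL2.equiv ℂ (fun _ : B9SectCLatticeCarrier.Plaq d Pd => c₀) W
        (covCurlL2K ℂ c₀ c (adTransportW φ U) (covDerivL2K ℂ c₀ c (adTransportW φ U) l)) p‖ ^ 2 ≤
      c₀ * (K ^ 2 * ‖lt (shift p.2.1.2 (shift p.2.1.1 p.1))‖ ^ 2) := fun p => by
    obtain ⟨x, q⟩ := p
    refine mul_le_mul_of_nonneg_left ?_ hc₀.le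
    rw [equiv_covCurlL2K, equiv_covDerivL2K, ← mul_pow]
    exact pow_le_pow_left₀ (norm_nonneg _) (norm_covCurl_covDeriv_le φ hMφ' hφ hφ' c hU hpl _ x q) 2
  calc ∑ p : B9SectCLatticeCarrier.Plaq d Pd, c₀ * ‖WL2.equiv ℂ (fun _ : B9SectCLatticeCarrier.Plaq d Pd => c₀) W
          (covCurlL2K ℂ c₀ c (adTransportW φ U) (covDerivL2K ℂ c₀ c (adTransportW φ U) l)) p‖ ^ 2
      ≤ ∑ p : B9SectCLatticeCarrier.Plaq d Pd, c₀ * (K ^ 2 * ‖lt (shift p.2.1.2 (shift p.2.1.1 p.1))‖ ^ 2) :=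
        Finset.sum_le_sum fun p _ => hpt p
    _ = K ^ 2 * ∑ q : DirPair d, ∑ x : TSite d Pd, c₀ * ‖lt (shift q.1.2 (shift q.1.1 x))‖ ^ 2 := by
        rw [Fintype.sum_prod_type, Finset.sum_comm, Finset.mul_sum]
        refine Finset.sum_congr rfl fun q _ => ?_
        rw [Finset.mul_sum]
        exact Finset.sum_congr rfl fun x _ => by ring
    _ = K ^ 2 * ∑ _q : DirPair d, ∑ z : TSite d Pd, c₀ * ‖lt z‖ ^ 2 := by
        congr 1
        refine Finset.sum_congr rfl fun q _ => ?_
        exact Fintype.sum_equiv ((shiftEquiv q.1.1).trans (shiftEquiv q.1.2)) _ _ fun x => rfl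
    _ = K ^ 2 * Fintype.card (DirPair d) * ∑ z : TSite d Pd, c₀ * ‖lt z‖ ^ 2 := by
        rw [Finset.sum_const, Finset.card_univ, nsmul_eq_mul]; ring

/-- **THE CURL OF A PURE GAUGE MODE IS SMALL IN `L²`**: `‖D_U(D_Uλ)‖ ≤ ‖c‖²·2ε·M_φ′M_φ·√#{μ<ν}·‖λ‖`.
[cite: Balaban1985BackgroundPropagators, (3.4) p.391, (3.36) p.396] -/
theorem norm_covCurlL2K_covDerivL2K_le (hMφ' : 0 ≤ Mφ') (hφ : ∀ w, ‖φ w‖ ≤ Mφ * ‖w‖) (hφ' : ∀ X, ‖φ.symm X‖ ≤ Mφ' * ‖X‖) (c : ℂ)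
    {U : Bond d Pd → 𝔸ˣ} (hU : ∀ b, U b ∈ U1 𝔸) {ε : ℝ} (hε : 0 ≤ ε) (hpl : ∀ p : B9SectCLatticeCarrier.Plaq d Pd, ‖(plaqHolU U p : 𝔸) - 1‖ ≤ ε)
    (hMφ : 0 ≤ Mφ) (l : SiteL2K ℂ d Pd c₀ W) :
    ‖covCurlL2K ℂ c₀ c (adTransportW φ U) (covDerivL2K ℂ c₀ c (adTransportW φ U) l)‖ ≤
      ‖c‖ ^ 2 * (2 * ε * (Mφ' * Mφ)) * Real.sqrt (Fintype.card (DirPair d)) * ‖l‖ := by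
  have h := norm_sq_covCurlL2K_covDerivL2K_le φ hMφ' hφ hφ' c hU hpl l
  refine (pow_le_pow_iff_left₀ (norm_nonneg _) (by positivity) two_ne_zero).1 (h.trans_eq ?_)
  rw [show (‖c‖ ^ 2 * (2 * ε * (Mφ' * Mφ)) * Real.sqrt (Fintype.card (DirPair d)) * ‖l‖) ^ 2 =
      (‖c‖ ^ 2 * (2 * ε * (Mφ' * Mφ))) ^ 2 * (Real.sqrt (Fintype.card (DirPair d))) ^ 2 * ‖l‖ ^ 2 by ring,
    Real.sq_sqrt (Nat.cast_nonneg _)]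

/-! ## §3 At the chain's small-field window: `c = η⁻¹`, `‖U(∂p) − 1‖ ≤ αη²` — the bound is `η`-FREE -/

/-- **`‖D_U(D_Uλ)‖_{L²} ≤ 2M_φ′M_φ√#{μ<ν}·α·‖λ‖_{L²}` — THE CURL OF A PURE GAUGE MODE IS `O(α)`, UNIFORMLY IN THE LATTICE SPACING**: at the scalar `η⁻¹` of
(3.3)–(3.4) and print's plaquette window `‖U(∂p) − 1‖ ≤ αη²` of (3.35), the two powers of `η⁻¹` are paid by the window (this is the `L²` content of (3.36)
the small-current reading: `Δ(U)(D_Uλ)`'s principal part is `D_U*` of this curl). [cite: Balaban1985BackgroundPropagators, (3.3)–(3.4) p.391, (3.35)–(3.36) p.396, (3.117) p.419] -/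
theorem norm_covCurlL2K_covDerivL2K_le_window (hMφ : 0 ≤ Mφ) (hMφ' : 0 ≤ Mφ') (hφ : ∀ w, ‖φ w‖ ≤ Mφ * ‖w‖)
    (hφ' : ∀ X, ‖φ.symm X‖ ≤ Mφ' * ‖X‖) {η : ℝ} (hη : η ≠ 0) {U : Bond d Pd → 𝔸ˣ} (hU : ∀ b, U b ∈ U1 𝔸) {α : ℝ} (hα : 0 ≤ α)
    (hpl : ∀ p : B9SectCLatticeCarrier.Plaq d Pd, ‖(plaqHolU U p : 𝔸) - 1‖ ≤ α * η ^ 2) (l : SiteL2K ℂ d Pd c₀ W) :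
    ‖covCurlL2K ℂ c₀ ((η : ℂ))⁻¹ (adTransportW φ U) (covDerivL2K ℂ c₀ ((η : ℂ))⁻¹ (adTransportW φ U) l)‖ ≤
      2 * (Mφ' * Mφ) * Real.sqrt (Fintype.card (DirPair d)) * α * ‖l‖ := by
  have h := norm_covCurlL2K_covDerivL2K_le φ hMφ' hφ hφ' ((η : ℂ))⁻¹ hU (by positivity : 0 ≤ α * η ^ 2) hpl hMφ l
  have hn : ‖((η : ℂ))⁻¹‖ ^ 2 * (α * η ^ 2) = α := by
    rw [norm_inv, Complex.norm_real, Real.norm_eq_abs, inv_pow, sq_abs]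
    field_simp
  refine h.trans_eq ?_
  rw [show ‖((η : ℂ))⁻¹‖ ^ 2 * (2 * (α * η ^ 2) * (Mφ' * Mφ)) = 2 * (Mφ' * Mφ) * (‖((η : ℂ))⁻¹‖ ^ 2 * (α * η ^ 2)) by ring, hn]
  ring

/-! ## §4 The Hessian (3.10) against a pure gauge mode: the current is small in `L²` -/

section Hessian

variable [StarRing 𝔸] [NormedStarGroup 𝔸] [StarModule ℂ 𝔸] [FiniteDimensional ℂ W]
  {τ : 𝔸 →ₗ[ℂ] ℂ} {Cτ : ℝ} (hτ : ∀ X, ‖τ X‖ ≤ Cτ * ‖X‖) (hCτ : 0 ≤ Cτ) (η : ℝ)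
  {U : Bond d Pd → 𝔸ˣ} (hU : ∀ b, ‖(U b : 𝔸)‖ ≤ 1 ∧ ‖(((U b)⁻¹ : 𝔸ˣ) : 𝔸)‖ ≤ 1) {ε : ℝ}
  (hpl : ∀ p : B9SectCLatticeCarrier.Plaq d Pd, ‖(plaqHolU U p : 𝔸) - 1‖ ≤ ε)

omit [NormOneClass 𝔸] [StarRing 𝔸] [NormedStarGroup 𝔸] [StarModule ℂ 𝔸] in
/-- **`|⟨u, D*Dw⟩| ≤ ‖D_Uu‖·‖D_Uw‖`** for the principal part of (3.10), the transporters mutually adjoint on the fibre (unitary background in the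
norming (18) — displayed `hRS`). [cite: Balaban1985BackgroundPropagators, (3.10) p.392, (3.4) p.391] -/
theorem norm_inner_principalOpK_le
    (hRS : ∀ (b : Bond d Pd) (v u : W), ⟪adTransportW φ U b v, u⟫_ℂ = ⟪v, adTransportW φ (fun b => (U b)⁻¹) b u⟫_ℂ)
    (u w : BondL2K ℂ d Pd c₀ W) :
    ‖⟪u, principalOpK φ η U w⟫_ℂ‖ ≤
      ‖covCurlL2K ℂ c₀ ((η : ℂ))⁻¹ (adTransportW φ U) u‖ * ‖covCurlL2K ℂ c₀ ((η : ℂ))⁻¹ (adTransportW φ U) w‖ := by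
  rw [principalOpK_eq_comp, covCoCurlL2K_comp_eq_adjoint_comp _ (by rw [map_inv₀, Complex.conj_ofReal]) _ _ hRS, LinearMap.comp_apply,
    LinearMap.adjoint_inner_right]
  exact norm_inner_le_norm _ _

include hτ hCτ hU hpl in
omit [NormOneClass 𝔸] in
/-- **THE HESSIAN (3.10) AGAINST A PURE GAUGE MODE** — the current `J` is small ((3.117), (3.36); paraphrase) in the `L²` ∕ energy currency:
`‖⟪u, Δ^η(U)(D_Uλ)⟫‖ ≤ ‖D_Uu‖·‖D_U(D_Uλ)‖ + 32d·C_τ·M_φ²·(|η|^d∕c₀)·(η⁻²ε)·‖u‖·‖D_Uλ‖` — the principal part pairs the curl of `u` with the holonomy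
commutator of §1–§2, the curvature part is the small bilinear form; with `B9Eq34CurlGaugeModeWindow.norm_covCurlL2K_covDerivL2K_le_window` both
terms are `O(α)` under print's plaquette window, uniformly in `η`.  (The transporters mutually adjoint on the fibre — `hRS`, displayed.)
[cite: Balaban1985BackgroundPropagators, (3.10) p.392, (3.36) p.396, (3.117) p.419, (3.120) p.419] -/
theorem norm_inner_hessOp_covDerivL2K_le (hMφ : 0 ≤ Mφ) (hφ : ∀ w, ‖φ w‖ ≤ Mφ * ‖w‖) (hε : 0 ≤ ε)
    (hRS : ∀ (b : Bond d Pd) (v u : W), ⟪adTransportW φ U b v, u⟫_ℂ = ⟪v, adTransportW φ (fun b => (U b)⁻¹) b u⟫_ℂ)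
    (u : BondL2K ℂ d Pd c₀ W) (l : SiteL2K ℂ d Pd c₀ W) :
    ‖⟪u, hessOp φ η U τ (covDerivL2K ℂ c₀ ((η : ℂ))⁻¹ (adTransportW φ U) l)⟫_ℂ‖ ≤
      ‖covCurlL2K ℂ c₀ ((η : ℂ))⁻¹ (adTransportW φ U) u‖ *
          ‖covCurlL2K ℂ c₀ ((η : ℂ))⁻¹ (adTransportW φ U) (covDerivL2K ℂ c₀ ((η : ℂ))⁻¹ (adTransportW φ U) l)‖ +
        32 * d * Cτ * Mφ ^ 2 * (|η| ^ d / c₀) * (‖((η : ℂ))⁻¹‖ ^ 2 * ε) * ‖covDerivL2K ℂ c₀ ((η : ℂ))⁻¹ (adTransportW φ U) l‖ * ‖u‖ := by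
  rw [hessOp_apply, inner_add_right]
  exact (norm_add_le _ _).trans (add_le_add (norm_inner_principalOpK_le φ η hRS u _) (norm_inner_curvOp_le φ hτ hCτ hφ η hU hpl hMφ hε u _))

end Hessian

/-! ## §5 At the chain's window: the Hessian against a pure gauge mode is `O(α)`, uniformly in `η` -/

section Window

variable [StarRing 𝔸] [NormedStarGroup 𝔸] [StarModule ℂ 𝔸] [FiniteDimensional ℂ W]
  {τ : 𝔸 →ₗ[ℂ] ℂ} {Cτ : ℝ} (hτ : ∀ X, ‖τ X‖ ≤ Cτ * ‖X‖) (hCτ : 0 ≤ Cτ) {η : ℝ} (hη : η ≠ 0)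
  {U : Bond d Pd → 𝔸ˣ} (hUb : ∀ b, U b ∈ U1 𝔸) {α : ℝ} (hα : 0 ≤ α)
  (hpl : ∀ p : B9SectCLatticeCarrier.Plaq d Pd, ‖(plaqHolU U p : 𝔸) - 1‖ ≤ α * η ^ 2) {ρw : ℝ} (hρ : |η| ^ d / c₀ ≤ ρw)

include hτ hCτ hη hUb hα hpl hρ in
/-- **THE CURRENT IS SMALL AT THE CHAIN's LETTERS, `η`-FREE**: at the scalar `η⁻¹`, under print's plaquette window `‖U(∂p) − 1‖ ≤ αη²`, the volume
letter `|η|^d∕c₀ ≤ ρ_w` and unit-bounded `U` with mutually adjoint transporters,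
`‖⟨u, Δ^η(U)(D_Uλ)⟩‖ ≤ α·(2M_φ′M_φ√#DirPair·‖D_Uu‖·‖λ‖ + 32dC_τM_φ²ρ_w·‖D_Uλ‖·‖u‖)` — both powers of `η⁻¹` of each term are paid by the window.
This is the shape the θ-letter of `B9Eq3130HessianSlotPerturbationDiagonal` consumes (with `‖D_Uu‖ ≤` the curl row of `N₁(u)` up to the transport
defect, and `‖λ‖, ‖D_Uλ‖ ≤ C·N₁(v)` for `λ = G′_kR_kD*_Uv`). [cite: Balaban1985BackgroundPropagators, (3.36) p.396, (3.117) p.419, (3.120) p.419, (3.130) p.421] -/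
theorem norm_inner_hessOp_covDerivL2K_le_window (hMφ : 0 ≤ Mφ) (hMφ' : 0 ≤ Mφ') (hφ : ∀ w, ‖φ w‖ ≤ Mφ * ‖w‖)
    (hφ' : ∀ X, ‖φ.symm X‖ ≤ Mφ' * ‖X‖)
    (hRS : ∀ (b : Bond d Pd) (v u : W), ⟪adTransportW φ U b v, u⟫_ℂ = ⟪v, adTransportW φ (fun b => (U b)⁻¹) b u⟫_ℂ)
    (u : BondL2K ℂ d Pd c₀ W) (l : SiteL2K ℂ d Pd c₀ W) :
    ‖⟪u, hessOp φ η U τ (covDerivL2K ℂ c₀ ((η : ℂ))⁻¹ (adTransportW φ U) l)⟫_ℂ‖ ≤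
      α * (2 * (Mφ' * Mφ) * Real.sqrt (Fintype.card (DirPair d)) * ‖covCurlL2K ℂ c₀ ((η : ℂ))⁻¹ (adTransportW φ U) u‖ * ‖l‖ +
        32 * d * Cτ * Mφ ^ 2 * ρw * ‖covDerivL2K ℂ c₀ ((η : ℂ))⁻¹ (adTransportW φ U) l‖ * ‖u‖) := by
  have hU : ∀ b, ‖(U b : 𝔸)‖ ≤ 1 ∧ ‖(((U b)⁻¹ : 𝔸ˣ) : 𝔸)‖ ≤ 1 := fun b => mem_U1.1 (hUb b)
  have hε : 0 ≤ α * η ^ 2 := by positivity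
  have h := norm_inner_hessOp_covDerivL2K_le φ hτ hCτ η hU hpl hMφ hφ hε hRS u l
  have hcurl := norm_covCurlL2K_covDerivL2K_le_window φ hMφ hMφ' hφ hφ' hη hUb hα hpl l
  have hn : ‖((η : ℂ))⁻¹‖ ^ 2 * (α * η ^ 2) = α := by
    rw [norm_inv, Complex.norm_real, Real.norm_eq_abs, inv_pow, sq_abs]
    field_simp
  rw [hn] at h
  have h1 : ‖covCurlL2K ℂ c₀ ((η : ℂ))⁻¹ (adTransportW φ U) u‖ *
        ‖covCurlL2K ℂ c₀ ((η : ℂ))⁻¹ (adTransportW φ U) (covDerivL2K ℂ c₀ ((η : ℂ))⁻¹ (adTransportW φ U) l)‖ ≤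
      ‖covCurlL2K ℂ c₀ ((η : ℂ))⁻¹ (adTransportW φ U) u‖ * (2 * (Mφ' * Mφ) * Real.sqrt (Fintype.card (DirPair d)) * α * ‖l‖) :=
    mul_le_mul_of_nonneg_left hcurl (norm_nonneg _)
  have h2 : 32 * d * Cτ * Mφ ^ 2 * (|η| ^ d / c₀) * α * ‖covDerivL2K ℂ c₀ ((η : ℂ))⁻¹ (adTransportW φ U) l‖ * ‖u‖ ≤
      32 * d * Cτ * Mφ ^ 2 * ρw * α * ‖covDerivL2K ℂ c₀ ((η : ℂ))⁻¹ (adTransportW φ U) l‖ * ‖u‖ := by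
    have h0 : 0 ≤ 32 * d * Cτ * Mφ ^ 2 := by positivity
    have h3 : 0 ≤ α * ‖covDerivL2K ℂ c₀ ((η : ℂ))⁻¹ (adTransportW φ U) l‖ * ‖u‖ := by positivity
    nlinarith [mul_le_mul_of_nonneg_left hρ h0]
  refine h.trans ((add_le_add h1 h2).trans_eq ?_)
  ring

end Window

end Literature.MathematicalPhysics.QuantumFieldTheory.Balaban1983to89.B9Eq34CurlGaugeModeWindow

end
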